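import Summits.BirchSwinnertonDyer.BirchSwinnertonDyer.Theorems.GenusKolyvaginAtTwoTorsionCellTorsionControlQuadratic
import Literature.NumberTheory.EllipticCurves.GaloisAction
import HarnessLib

/-!
# LINE 49 «full_vertex» — LEVEL-0 RIGIDITY (the pen's LEMMA L0, memo #6 r4 §4bis.7): norm rigidity of a half over `K₀`

Crux R″ `RankOneTwoTorsionResidualAtTwo` (stmt-BirchSwinnertonDyer-27478) of route GenusKolyvaginAtTwo, LINE 49
«torsion_cell_full_vertex_bsdidea1» (pen bsd-idea-1).  SUPPORT mathematics for the line's research stubs F0aJ′ / F0bJ via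
the lower bound (LOW)_2: the pen's LEMMA L0 «level-`0` glue is impossible» (no order-`4` class of `E₀(K_gen)/(M′ + tors)` has
support `{−p₀}`) — the ingredient that, with the P_τ-lemma (`…GenusParity.pTau_lemma`) and the P-admissibility table,
gives THEOREM F10-B⁺⁺ «(LOW)_2 in full outside 𝔉, GZ-formula-free».  The memo calls L0 «PAPER + per-base checks» because
«(KUM), (MQ) are not in Mathlib».  The tree DOES have the complete `2`-descent (Kummer) map with its kernel
(`Literature/…/TwoDescent.lean`: `twoDescentComponent_add`, `exists_add_self_of_twoDescentComponent_eq_one`) and torsion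
control over the quadratic layer (`…TorsionCellTorsionControl[Quadratic]`), so steps (3)–(5) of the memo's proof are
KERNEL theorems here; only steps (1)–(2) (the Kummer class of the half `R` is RATIONAL, via multiquadratic Kummer theory
(MQ) over `K_gen/K₀`) remain an explicit hypothesis, in the form «the Kummer class of `R` is `σ`-invariant» or the
sufficient «`x(R) − eᵢ ∈ F^× · K²`».

Setting: `W/F` (`char 0`) with rational `2`-torsion `W.toAffine.SplitTwoTorsion e₁ e₂ e₃`; `K ⊇ F` a field with the
Galois action `σ • P` of `σ ∈ Aut(K/F)` on `E(K) = (W.baseChange K).toAffine.Point` (tree `GaloisAction.lean`); `ι = incl`.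

* §1 `exists_eq_mul_sq_of_sqClass_eq`; **`twoDescentComponent_smul_of_rational`** — if `x(P) − e₁ = a · u²` with `a ∈ F`
  then the `T₁`-component of the Kummer class of `σ • P` equals that of `P` (memo step (3), first half: «`σ` fixes rational
  classes»); `twoDescentComponent_smul_of_sqClass_eq` (the same from `κ₁(P) = class of a ∈ F`).
* §2 **`exists_add_self_eq_add_smul`** — if both Kummer components of `σ • R` equal those of `R`, then `R + σ • R ∈ 2E(K)`
  (memo step (3): `κ(R + σR) = κ(R)² = 1` and `ker κ = 2E(K)`, tree).
* §3 **`smul_eq_neg_of_half`** (L0 CORE, memo steps (4)–(5)): if moreover `R + R = g + t` with `σ • g = −g`, `σ • t = t`,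
  `t + t = O`, rational halves of rational points are rational over `K` (torsion control (i), hypothesis `hTC`) and `E(F)`
  has no point of order `4` (`hT4`), then `σ • R = −R` — so `g = 2R − t` is twice an ANTI-invariant point up to
  `2`-torsion, contradicting the primitivity of `g = g′_{−p₀}` in `E₀(K₀)⁻/tors` (`not_primitive_of_half`).
* §4 **`smul_eq_neg_of_half_cell`** — the GK2 / LINE 49 reading with `hTC` DISCHARGED: `E₀/ℚ` with `eᵢ ∈ ℤ`,
  `p₀ ∤ (eᵢ − eⱼ)`, `p₀ ∤ M₀ ≠ 0`, `K₀ = ℚ(r)`, `r² = −p₀M₀` (tree `…TorsionControl.exists_add_self_of_incl_cell`); the only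
  remaining inputs are (T4) and the rationality/`σ`-invariance of the Kummer class of `R`.

Pure `2`-descent rigidity: no Heegner point, residue symbol or `L`-function.  Everything is proved (no `sorry`, standard
axioms); nothing here is a statement of the line, and NOTHING HERE PROVES R″ or any summit — BSD is not advanced by this
file alone.

## References

* [SilvermanAEC2009] J. H. Silverman, *The Arithmetic of Elliptic Curves*, 2nd ed. (2009), Prop. X.1.4 (complete
  `2`-descent: the Kummer map, its kernel `2E(K)`, Galois equivariance), VIII.§1–§2.
* [Kramer1981] K. Kramer, *Arithmetic of elliptic curves upon quadratic extension*, Trans. AMS 264 (1981), §1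
  (`E(K)` under the quadratic involution; norms and anti-invariant points).
-/

open WeierstrassCurve WeierstrassCurve.Affine
open WeierstrassCurve.Affine.Point hiding some
open WeierstrassCurve.QuadraticDescent (incl incl_injective conjMap_incl)
open scoped Classical

noncomputable section

namespace Summit.BirchSwinnertonDyer.BirchSwinnertonDyer.Theorems.GenusKolyvaginAtTwo.FullVertex.LevelZero

universe u

/-! ## §1 Rational Kummer classes are `σ`-invariant -/

section Rational

variable {F K : Type u} [Field F] [Field K] [Algebra F K] {W : WeierstrassCurve F} {e₁ e₂ e₃ : F}

omit [Algebra F K] in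
/-- Square classes: `[b] = [a]` in `K^×/K^{×2}` (`a, b ≠ 0`) iff `b = a · u²` for some `u`. [cite: SilvermanAEC2009, Prop. X.1.4] -/
theorem exists_eq_mul_sq_of_sqClass_eq {a b : K} (ha : a ≠ 0) (hb : b ≠ 0) (h : sqClass b = sqClass a) :
    ∃ u : K, b = a * u ^ 2 := by
  have h1 : sqClass (b * a) = 1 := by rw [sqClass_mul hb ha, h, SqUnits.mul_self]
  obtain ⟨w, hw⟩ := (sqClass_eq_one_iff (mul_ne_zero hb ha)).mp h1
  refine ⟨w / a, ?_⟩
  field_simp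
  linear_combination hw

/-- **`σ` fixes rational Kummer classes** (memo step (3), first half).  For `P = (x, y) ∈ E(K)`: if `x − e₁ = a · u²` with
`a ∈ F` whenever `x ≠ e₁`, then the `T₁`-component of the Kummer class of `σ • P` equals that of `P`, for every
`σ ∈ Aut(K/F)` (`σ(x) − e₁ = a · σ(u)²`; at `x = e₁` both are the rational constant `(e₁−e₂)(e₁−e₃)`).
[cite: SilvermanAEC2009, Prop. X.1.4] -/
theorem twoDescentComponent_smul_of_rational (σ : K ≃ₐ[F] K) {x y : K}
    (hxy : (W.baseChange K).toAffine.Nonsingular x y)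
    (hrat : x ≠ algebraMap F K e₁ → ∃ (a : F) (u : K), x - algebraMap F K e₁ = algebraMap F K a * u ^ 2) :
    twoDescentComponent (W.baseChange K).toAffine (algebraMap F K e₁) (algebraMap F K e₂) (algebraMap F K e₃)
        (σ • Point.some x y hxy) =
      twoDescentComponent (W.baseChange K).toAffine (algebraMap F K e₁) (algebraMap F K e₂) (algebraMap F K e₃)
        (Point.some x y hxy) := by
  rw [WeierstrassCurve.smul_def, Affine.Point.map_some]
  by_cases hx : x = algebraMap F K e₁
  · have hσx : (σ : K →ₐ[F] K) x = algebraMap F K e₁ := by rw [hx, AlgHom.commutes]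
    rw [twoDescentComponent_some_of_eq _ hσx, twoDescentComponent_some_of_eq _ hx]
  · have hσx : (σ : K →ₐ[F] K) x ≠ algebraMap F K e₁ := by
      intro h'
      apply hx
      apply σ.injective
      rw [AlgEquiv.commutes]
      exact h'
    obtain ⟨a, u, hau⟩ := hrat hx
    have hx0 : x - algebraMap F K e₁ ≠ 0 := sub_ne_zero.mpr hx
    have ha0 : algebraMap F K a ≠ 0 := by
      intro h0; rw [h0, zero_mul] at hau; exact hx0 hau
    have hu0 : u ≠ 0 := by
      intro h0; rw [h0, zero_pow two_ne_zero, mul_zero] at hau; exact hx0 hau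
    have hσu0 : (σ : K →ₐ[F] K) u ≠ 0 := fun h0 => hu0 (σ.injective (h0.trans (_root_.map_zero σ).symm))
    have hσ : (σ : K →ₐ[F] K) x - algebraMap F K e₁ = algebraMap F K a * ((σ : K →ₐ[F] K) u) ^ 2 := by
      have := congrArg (σ : K →ₐ[F] K) hau
      rw [map_sub, AlgHom.commutes, map_mul, AlgHom.commutes, map_pow] at this
      exact this
    rw [twoDescentComponent_some_of_ne _ hσx, twoDescentComponent_some_of_ne _ hx, hσ, hau,
      sqClass_mul ha0 (pow_ne_zero 2 hu0), sqClass_mul ha0 (pow_ne_zero 2 hσu0), sqClass_sq, sqClass_sq]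

/-- The same from the class form «`κ₁(P) =` the class of some `a ∈ F^×`» (the output of the memo's steps (1)–(2):
`κ_{K₀}(R) ∈ ι₀((ℚ^×/□)²)`). [cite: SilvermanAEC2009, Prop. X.1.4] -/
theorem twoDescentComponent_smul_of_sqClass_eq (σ : K ≃ₐ[F] K) {x y : K}
    (hxy : (W.baseChange K).toAffine.Nonsingular x y) {a : F} (ha : algebraMap F K a ≠ 0)
    (hcls : x ≠ algebraMap F K e₁ → sqClass (x - algebraMap F K e₁) = sqClass (algebraMap F K a)) :
    twoDescentComponent (W.baseChange K).toAffine (algebraMap F K e₁) (algebraMap F K e₂) (algebraMap F K e₃)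
        (σ • Point.some x y hxy) =
      twoDescentComponent (W.baseChange K).toAffine (algebraMap F K e₁) (algebraMap F K e₂) (algebraMap F K e₃)
        (Point.some x y hxy) :=
  twoDescentComponent_smul_of_rational σ hxy fun hx =>
    ⟨a, exists_eq_mul_sq_of_sqClass_eq ha (sub_ne_zero.mpr hx) (hcls hx)⟩

end Rational

/-! ## §2 `σ`-invariant Kummer class ⟹ `R + σR ∈ 2E(K)` (memo step (3)) -/

section Norm

variable {F K : Type u} [Field F] [Field K] [Algebra F K] [CharZero F] [CharZero K]
  {W : WeierstrassCurve F} [W.IsElliptic] {e₁ e₂ e₃ : F}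

omit [CharZero F] in
/-- **Norm of a point with `σ`-invariant Kummer class is twice a point.**  If both components of the complete `2`-descent
map take the same value on `σ • R` and on `R`, then `κ(R + σ • R) = κ(R)² = 1`, so `R + σ • R = S + S` for some
`S ∈ E(K)` (the kernel of the Kummer map is `2E(K)`, tree `exists_add_self_of_twoDescentComponent_eq_one`).
[cite: SilvermanAEC2009, Prop. X.1.4] [cite: Kramer1981, §1] -/
theorem exists_add_self_eq_add_smul (h : W.toAffine.SplitTwoTorsion e₁ e₂ e₃) (σ : K ≃ₐ[F] K)
    (R : (W.baseChange K).toAffine.Point)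
    (h₁ : twoDescentComponent (W.baseChange K).toAffine (algebraMap F K e₁) (algebraMap F K e₂)
        (algebraMap F K e₃) (σ • R) =
      twoDescentComponent (W.baseChange K).toAffine (algebraMap F K e₁) (algebraMap F K e₂) (algebraMap F K e₃) R)
    (h₂ : twoDescentComponent (W.baseChange K).toAffine (algebraMap F K e₂) (algebraMap F K e₁)
        (algebraMap F K e₃) (σ • R) =
      twoDescentComponent (W.baseChange K).toAffine (algebraMap F K e₂) (algebraMap F K e₁) (algebraMap F K e₃) R) :
    ∃ S : (W.baseChange K).toAffine.Point, S + S = R + σ • R := by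
  haveI : (W.baseChange K).IsElliptic := inferInstanceAs ((W.map (algebraMap F K)).IsElliptic)
  have hK := TorsionControl.splitTwoTorsion_baseChange (L := K) h
  refine exists_add_self_of_twoDescentComponent_eq_one hK _ ?_ ?_
  · rw [twoDescentComponent_add hK, h₁, SqUnits.mul_self]
  · rw [twoDescentComponent_add hK.swap₁₂, h₂, SqUnits.mul_self]

omit [CharZero F] in
/-- §2 for an affine point with RATIONAL Kummer data: if `x(R) − e₁ ∈ a₁ · K²` and `x(R) − e₂ ∈ a₂ · K²` (`aᵢ ∈ F`), then
`R + σ • R ∈ 2E(K)` for every `σ ∈ Aut(K/F)`. [cite: SilvermanAEC2009, Prop. X.1.4] [cite: Kramer1981, §1] -/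
theorem exists_add_self_eq_add_smul_of_rational (h : W.toAffine.SplitTwoTorsion e₁ e₂ e₃) (σ : K ≃ₐ[F] K)
    {x y : K} (hxy : (W.baseChange K).toAffine.Nonsingular x y)
    (hrat₁ : x ≠ algebraMap F K e₁ → ∃ (a : F) (u : K), x - algebraMap F K e₁ = algebraMap F K a * u ^ 2)
    (hrat₂ : x ≠ algebraMap F K e₂ → ∃ (a : F) (u : K), x - algebraMap F K e₂ = algebraMap F K a * u ^ 2) :
    ∃ S : (W.baseChange K).toAffine.Point, S + S = Point.some x y hxy + σ • Point.some x y hxy :=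
  exists_add_self_eq_add_smul h σ _ (twoDescentComponent_smul_of_rational σ hxy hrat₁)
    (twoDescentComponent_smul_of_rational (e₁ := e₂) (e₂ := e₁) σ hxy hrat₂)

end Norm

/-! ## §3 L0 core: a half of an anti-invariant point with `σ`-invariant Kummer class is anti-invariant (memo steps (4)–(5)) -/

section Core

variable {F K : Type u} [Field F] [Field K] [Algebra F K] [CharZero F] [CharZero K]
  {W : WeierstrassCurve F} [W.IsElliptic] {e₁ e₂ e₃ : F}

omit [CharZero F] [CharZero K] [W.IsElliptic] in
/-- `T″ := R + σR` is `2`-torsion when `2R = g + t`, `σg = −g`, `σt = t`, `2t = O`. [cite: Kramer1981, §1] -/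
theorem add_smul_add_add_smul_eq_zero (σ : K ≃ₐ[F] K) {R g t : (W.baseChange K).toAffine.Point}
    (hR : R + R = g + t) (hg : σ • g = -g) (ht : σ • t = t) (h2t : t + t = 0) :
    (R + σ • R) + (R + σ • R) = 0 := by
  have hσ : σ • R + σ • R = -g + t := by rw [← smul_add, hR, smul_add, hg, ht]
  calc (R + σ • R) + (R + σ • R) = (R + R) + (σ • R + σ • R) := by abel
    _ = (g + t) + (-g + t) := by rw [hR, hσ]
    _ = t + t := by abel
    _ = 0 := h2t

/-- **L0 CORE (memo #6 §4bis.7, steps (3)–(5)).**  `W/F` with rational `2`-torsion, `σ ∈ Aut(K/F)`, `R, g, t ∈ E(K)` with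
`R + R = g + t`, `σ • g = −g`, `σ • t = t`, `t + t = O`; the Kummer class of `R` is `σ`-invariant (both components); every
`F`-point halvable in `E(K)` is halvable in `E(F)` (`hTC`, torsion control (i)); and `E(F)` has no point of order `4`
(`hT4`).  Then `σ • R = −R`.  Proof: `T″ := R + σR ∈ 2E(K)` (§2) is `2`-torsion, hence `= ι Q₀` with `Q₀ ∈ E(F)[2]`
(tree `…TorsionControl.mem_range_map_of_add_self_eq_zero`), `Q₀` is halvable over `K` hence over `F` by `Q₁` with
`4Q₁ = O`, so `2Q₁ = O = Q₀` and `T″ = O`. [cite: SilvermanAEC2009, Prop. X.1.4] [cite: Kramer1981, §1] -/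
theorem smul_eq_neg_of_half (h : W.toAffine.SplitTwoTorsion e₁ e₂ e₃) (σ : K ≃ₐ[F] K)
    {R g t : (W.baseChange K).toAffine.Point} (hR : R + R = g + t) (hg : σ • g = -g) (ht : σ • t = t)
    (h2t : t + t = 0)
    (h₁ : twoDescentComponent (W.baseChange K).toAffine (algebraMap F K e₁) (algebraMap F K e₂)
        (algebraMap F K e₃) (σ • R) =
      twoDescentComponent (W.baseChange K).toAffine (algebraMap F K e₁) (algebraMap F K e₂) (algebraMap F K e₃) R)
    (h₂ : twoDescentComponent (W.baseChange K).toAffine (algebraMap F K e₂) (algebraMap F K e₁)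
        (algebraMap F K e₃) (σ • R) =
      twoDescentComponent (W.baseChange K).toAffine (algebraMap F K e₂) (algebraMap F K e₁) (algebraMap F K e₃) R)
    (hTC : ∀ Q₀ : W.toAffine.Point, (∃ S : (W.baseChange K).toAffine.Point, S + S = incl K W Q₀) →
      ∃ Q₁ : W.toAffine.Point, Q₁ + Q₁ = Q₀)
    (hT4 : ∀ Q : W.toAffine.Point, (4 : ℕ) • Q = 0 → (2 : ℕ) • Q = 0) :
    σ • R = -R := by
  obtain ⟨S, hS⟩ := exists_add_self_eq_add_smul h σ R h₁ h₂
  have h2T := add_smul_add_add_smul_eq_zero σ hR hg ht h2t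
  -- `T″` is `F`-rational
  obtain ⟨Q₀, hQ₀⟩ := TorsionControl.mem_range_map_of_add_self_eq_zero h (R + σ • R) h2T
  -- and `2`-torsion in `E(F)`
  have h2Q₀ : Q₀ + Q₀ = 0 :=
    incl_injective (K := K) W (by rw [map_add, hQ₀, _root_.map_zero]; exact h2T)
  -- `Q₀` is halvable over `K`, hence over `F`
  obtain ⟨Q₁, hQ₁⟩ := hTC Q₀ ⟨S, by rw [hS, hQ₀]⟩
  have h4 : (4 : ℕ) • Q₁ = 0 := by
    rw [show (4 : ℕ) = 2 * 2 from rfl, mul_smul, two_nsmul Q₁, hQ₁, two_nsmul, h2Q₀]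
  have hQ₀0 : Q₀ = 0 := by rw [← hQ₁, ← two_nsmul, hT4 Q₁ h4]
  have hT0 : R + σ • R = 0 := by rw [← hQ₀, hQ₀0, _root_.map_zero]
  exact eq_neg_of_add_eq_zero_right hT0

/-- **L0 as a non-primitivity statement.**  Under the hypotheses of `smul_eq_neg_of_half`, `g` is twice the
ANTI-invariant point `R` up to the `2`-torsion point `t`: `∃ R′, σ • R′ = −R′ ∧ R′ + R′ = g + t`.  In memo #6 this contradicts
the primitivity of `g = g′_{−p₀}` in `E₀(K₀)⁻/tors`: LEVEL-`0` GLUE IS IMPOSSIBLE. [cite: Kramer1981, §1] -/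
theorem exists_anti_half_of_half (h : W.toAffine.SplitTwoTorsion e₁ e₂ e₃) (σ : K ≃ₐ[F] K)
    {R g t : (W.baseChange K).toAffine.Point} (hR : R + R = g + t) (hg : σ • g = -g) (ht : σ • t = t)
    (h2t : t + t = 0)
    (h₁ : twoDescentComponent (W.baseChange K).toAffine (algebraMap F K e₁) (algebraMap F K e₂)
        (algebraMap F K e₃) (σ • R) =
      twoDescentComponent (W.baseChange K).toAffine (algebraMap F K e₁) (algebraMap F K e₂) (algebraMap F K e₃) R)
    (h₂ : twoDescentComponent (W.baseChange K).toAffine (algebraMap F K e₂) (algebraMap F K e₁)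
        (algebraMap F K e₃) (σ • R) =
      twoDescentComponent (W.baseChange K).toAffine (algebraMap F K e₂) (algebraMap F K e₁) (algebraMap F K e₃) R)
    (hTC : ∀ Q₀ : W.toAffine.Point, (∃ S : (W.baseChange K).toAffine.Point, S + S = incl K W Q₀) →
      ∃ Q₁ : W.toAffine.Point, Q₁ + Q₁ = Q₀)
    (hT4 : ∀ Q : W.toAffine.Point, (4 : ℕ) • Q = 0 → (2 : ℕ) • Q = 0) :
    ∃ R' : (W.baseChange K).toAffine.Point, σ • R' = -R' ∧ R' + R' = g + t :=
  ⟨R, smul_eq_neg_of_half h σ hR hg ht h2t h₁ h₂ hTC hT4, hR⟩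

/-- **L0, contrapositive form used by THEOREM F10-B⁺⁺:** if `g` is PRIMITIVE in the anti-invariant part up to `2`-torsion
(no `R′` with `σ • R′ = −R′` and `R′ + R′ = g + t`), then NO point `R ∈ E(K)` with `σ`-invariant Kummer class halves `g + t`.
[cite: Kramer1981, §1] -/
theorem not_half_of_primitive (h : W.toAffine.SplitTwoTorsion e₁ e₂ e₃) (σ : K ≃ₐ[F] K)
    {g t : (W.baseChange K).toAffine.Point} (hg : σ • g = -g) (ht : σ • t = t) (h2t : t + t = 0)
    (hprim : ∀ R' : (W.baseChange K).toAffine.Point, σ • R' = -R' → R' + R' ≠ g + t)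
    (hTC : ∀ Q₀ : W.toAffine.Point, (∃ S : (W.baseChange K).toAffine.Point, S + S = incl K W Q₀) →
      ∃ Q₁ : W.toAffine.Point, Q₁ + Q₁ = Q₀)
    (hT4 : ∀ Q : W.toAffine.Point, (4 : ℕ) • Q = 0 → (2 : ℕ) • Q = 0)
    (R : (W.baseChange K).toAffine.Point)
    (h₁ : twoDescentComponent (W.baseChange K).toAffine (algebraMap F K e₁) (algebraMap F K e₂)
        (algebraMap F K e₃) (σ • R) =
      twoDescentComponent (W.baseChange K).toAffine (algebraMap F K e₁) (algebraMap F K e₂) (algebraMap F K e₃) R)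
    (h₂ : twoDescentComponent (W.baseChange K).toAffine (algebraMap F K e₂) (algebraMap F K e₁)
        (algebraMap F K e₃) (σ • R) =
      twoDescentComponent (W.baseChange K).toAffine (algebraMap F K e₂) (algebraMap F K e₁) (algebraMap F K e₃) R) :
    R + R ≠ g + t := fun hR =>
  hprim R (smul_eq_neg_of_half h σ hR hg ht h2t h₁ h₂ hTC hT4) hR

end Core

/-! ## §4 The GK2 / LINE 49 cell: `K₀ = ℚ(√−p₀M₀)`, integral full-`2`-torsion base — torsion control discharged -/

section Cell

variable {K : Type} [Field K] [Algebra ℚ K] [CharZero K] {W : WeierstrassCurve ℚ} [W.IsElliptic]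

/-- **L0 CORE over `K₀ = ℚ(√−p₀M₀)`** for an integral full-`2`-torsion base `E₀/ℚ` (`eᵢ ∈ ℤ`, `p₀ ∤ eᵢ − eⱼ`, `p₀ ∤ M₀ ≠ 0`,
`K₀ = ℚ(r)`, `r² = −p₀M₀`; memo #6: `M₀ = 1`), `σ ∈ Aut(K₀/ℚ)`: a point `R ∈ E₀(K₀)` with `σ`-invariant Kummer class and
`R + R = g + t`, `σ • g = −g`, `σ • t = t`, `t + t = O`, is ANTI-invariant, `σ • R = −R` — provided `E₀(ℚ)` has no point of
order `4` (T4).  Torsion control (i) is the tree's `…TorsionControl.exists_add_self_of_incl_cell` (unconditional).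
[cite: SilvermanAEC2009, Prop. X.1.4] [cite: Kramer1981, §1] -/
theorem smul_eq_neg_of_half_cell [DecidableEq ℚ] {e₁ e₂ e₃ : ℤ}
    (h : W.toAffine.SplitTwoTorsion (e₁ : ℚ) (e₂ : ℚ) (e₃ : ℚ))
    (p₀ M₀ : ℕ) [Fact p₀.Prime] (h₁₂ : ¬ (p₀ : ℤ) ∣ e₁ - e₂) (h₁₃ : ¬ (p₀ : ℤ) ∣ e₁ - e₃)
    (h₂₃ : ¬ (p₀ : ℤ) ∣ e₂ - e₃) (hM : ¬ p₀ ∣ M₀) (hM0 : M₀ ≠ 0) {r : K}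
    (hr : r ^ 2 = algebraMap ℚ K (-((p₀ * M₀ : ℕ) : ℚ)))
    (hgen : ∀ w : K, ∃ a b : ℚ, w = algebraMap ℚ K a + algebraMap ℚ K b * r)
    (hT4 : ∀ Q : W.toAffine.Point, (4 : ℕ) • Q = 0 → (2 : ℕ) • Q = 0)
    (σ : K ≃ₐ[ℚ] K) {R g t : (W.baseChange K).toAffine.Point} (hR : R + R = g + t) (hg : σ • g = -g)
    (ht : σ • t = t) (h2t : t + t = 0)
    (hκ₁ : twoDescentComponent (W.baseChange K).toAffine (algebraMap ℚ K e₁) (algebraMap ℚ K e₂)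
        (algebraMap ℚ K e₃) (σ • R) =
      twoDescentComponent (W.baseChange K).toAffine (algebraMap ℚ K e₁) (algebraMap ℚ K e₂) (algebraMap ℚ K e₃) R)
    (hκ₂ : twoDescentComponent (W.baseChange K).toAffine (algebraMap ℚ K e₂) (algebraMap ℚ K e₁)
        (algebraMap ℚ K e₃) (σ • R) =
      twoDescentComponent (W.baseChange K).toAffine (algebraMap ℚ K e₂) (algebraMap ℚ K e₁) (algebraMap ℚ K e₃) R) :
    σ • R = -R := by
  -- the group law on `E(ℚ)` is polymorphic in the (irrelevant) `DecidableEq ℚ` instance: bridge with `convert`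
  refine smul_eq_neg_of_half h σ hR hg ht h2t hκ₁ hκ₂ (fun Q₀ hQ₀ => ?_) (fun Q hQ => ?_)
  · obtain ⟨P, hP⟩ := TorsionControl.exists_add_self_of_incl_cell h p₀ M₀ h₁₂ h₁₃ h₂₃ hM hM0 hr hgen Q₀ hQ₀
    exact ⟨P, by convert hP⟩
  · have h4 : (4 : ℕ) • Q = 0 := by convert hQ
    convert hT4 Q h4

end Cell

end Summit.BirchSwinnertonDyer.BirchSwinnertonDyer.Theorems.GenusKolyvaginAtTwo.FullVertex.LevelZero

end
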